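import Summits.BirchSwinnertonDyer.BirchSwinnertonDyer.Theorems.CMKolyvaginAtInertTwoCMKolyvaginConjectureAtInertTwoPositiveDepthDatumFreeAllLevels
import Summits.BirchSwinnertonDyer.BirchSwinnertonDyer.Theorems.CMKolyvaginAtInertTwoCMKolyvaginConjectureAtInertTwoShallowGenusDescent
import HarnessLib

/-!
# Crux `CMKolyvaginConjectureAtInertTwo` (stmt-BirchSwinnertonDyer-24648), open stub `stub_positiveDepth`:
# AT AN ALL-SHALLOW LEVEL (`ℓ ≡ 1 (mod 4)` for every `ℓ ∣ n`) THE WITNESS DESCENDS TO THE GENUS `2`-LAYER —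
# `P(n) ∈ 2E(K[n]) ⟺` the genus trace has a half fixed by every `σ_ℓ²` and negated by every `σ_ℓ`

Route `CMKolyvaginAtInertTwo` (cell `pub/bsd-eis`, seat `leafhand-bsd-cmkolyvaginatinert-2` g0); helper (`--supports
stmt-BirchSwinnertonDyer-24648 --as helper`). THEOREMS ONLY (no definition, no named fact, no `sorry`); closes nothing;
BSD is proved for no curve. Composite-level sequel of this seat's `…ShallowGenusDescent` (prime level) over p795141's
genus-trace form and p799182's datum-free toolkit.

WHAT. At a square-free level `n` whose prime factors `ℓ` are Zhang–Kolyvagin primes at `2` inert in `F`, write `G_ℓ = ⟨σ_ℓ⟩`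
(order `ℓ+1`), `H_n = ⟨σ_ℓ² : ℓ ∣ n⟩` (order `∏ (ℓ+1)/2`), `𝒩_n = ∏_{ℓ∣n} Σ_{k<(ℓ+1)/2} σ_ℓ^{2k}` (the `H_n`-norm) and
`G = Σ_{s∈S} s(𝒩_n y(n))` (the GENUS TRACE; p795141: `P(n) ∈ 2E(K[n]) ⟺ G ∈ 2E(K[n])`). The level is ALL-SHALLOW when every
`ℓ ∣ n` has `M(ℓ) = 1`, i.e. `ℓ ≡ 1 (mod 4)` (`a_ℓ = 0`), i.e. `|H_n|` is ODD. Then: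

* §1 (algebra) `two_dvd_iff_exists_forall_fixed_of_odd` — for pairwise commuting `τ_q` (`q ∈ L`) of ODD exponents
  `m_q` (`τ_q^{m_q} = 1`) all fixing `z`: `z ∈ 2A ⟺ z = 2Q` with `Q` fixed by EVERY `τ_q` (successive averaging,
  `two_dvd_iff_two_dvd_fixed_of_odd` of `…ShallowGenusDescent` made equivariant).
* §2 `map_σ_sq_foldr_normPart_eq_self` — `σ_ℓ² 𝒩_L y = 𝒩_L y` for `ℓ ∈ L` (rotation of the `ℓ`-factor, commutation past the
  others); `pointGalHom_σ_sq_genusTrace` / `pointGalHom_σ_genusTrace_eq_neg` — every `σ_ℓ²` fixes and every `σ_ℓ` negates the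
  genus trace `G` (`𝒢_n` abelian; p799182 `map_σ_foldr_normPart_eq_neg`);
  **`two_dvd_derivedPoint_iff_exists_forall_fixed_of_allShallow`** — at an all-shallow level:
  `P(n) ∈ 2E(K[n]) ⟺ ∃ Q, (∀ ℓ ∣ n, σ_ℓ²Q = Q) ∧ 2Q = G` (the half lives in `E(K[n])^{H_n} = E(L_n)`, `L_n` the genus
  `2`-layer, `Gal(L_n/K[1]) ≃ (ℤ/2)^{ν(n)}`);
  **`two_dvd_derivedPoint_iff_exists_forall_anti_of_allShallow`** — on H₂ (`2` inert in `F`, `ρ̄_{E,2}` onto, so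
  `E(K[n])[2] = 0` by tree `twoTorsion_eq_zero_ringClassField_of_cmInert_two_of_heegner`, the CM prime not dividing `n`):
  `P(n) ∈ 2E(K[n]) ⟺ ∃ Q, (∀ ℓ ∣ n, σ_ℓ²Q = Q ∧ σ_ℓ Q = −Q) ∧ 2Q = G` — the half is a point of `E(L_n)` on which EVERY `σ_ℓ`
  acts by `−1`, i.e. of the `χ_n`-isotypic part for the ONE genus character `χ_n` of `Gal(L_n/K[1])` with `χ_n(σ_ℓ) = −1` for
  all `ℓ ∣ n`: a `K[1]`-point of the quadratic twist `E^{(χ_n)}` (for `ℓ ≡ 1 (mod 4)` throughout, `χ_n` cuts out `K[1](√n)`).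
  READING (not formalised): the all-shallow part of Kolyvagin's conjecture at `2` on H₂ is a level-ONE `2`-indivisibility of a
  genus Heegner point on the quadratic twists `E^{(n)}`, `n ≡ 1 (mod 4)` square-free products of CM-inert Kolyvagin primes —
  Goldfeld / Birch-lemma territory — while deep levels are the `M ≥ 2` descent (p799717: BSD-inconsistent off `Σ ≤ 1`).

HONEST FRAMING: elementary group bookkeeping over tree theorems; the twist identification and any non-vanishing are NOT
formalised; mixed levels (some `ℓ ≡ 3 (mod 4)`) are not treated; no stub is closed; BSD is proved for no curve.
[cite: GrossLMS1991, §3 (3.5), Prop. 3.7 (1), §4 (4.1), Lemma 4.3] [cite: WZhang2014, Notations (xii), §3.7]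
[cite: Cox2013, §7.D, §9.A (genus theory of orders)]
-/

set_option linter.dupNamespace false -- `Summit.BirchSwinnertonDyer.BirchSwinnertonDyer.Theorems.…` (summit = sub)
set_option autoImplicit false

noncomputable section

open scoped Classical

namespace Summit.BirchSwinnertonDyer.BirchSwinnertonDyer.Theorems.CMKolyvaginConjecturePositiveDepth

open Finset

/-! ## §1 Algebra: equivariant averaging over commuting cyclic groups of odd order -/

section Algebra

variable {G : Type*} [Group G] {A : Type*} [AddCommGroup A] (ρ : G →* AddMonoid.End A)

/-- **Equivariant averaging over commuting cyclic groups of ODD order**: for pairwise commuting `τ_q` (`q ∈ L`) with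
`τ_q^{m_q} = 1`, `m_q` odd, all fixing `z`: `z ∈ 2A ⟺ z = 2Q` for some `Q` fixed by EVERY `τ_q` (average a square root over
`⟨τ_q⟩` one `q` at a time; commuting operators preserve the fixed points already gained). [folklore] -/
theorem two_dvd_iff_exists_forall_fixed_of_odd (τ : ℕ → G) (m : ℕ → ℕ) (L : List ℕ)
    (hcomm : ∀ q ∈ L, ∀ q' ∈ L, Commute (τ q) (τ q')) (hodd : ∀ q ∈ L, Odd (m q))
    (hτ : ∀ q ∈ L, τ q ^ m q = 1) (z : A) (hz : ∀ q ∈ L, ρ (τ q) z = z) :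
    (∃ Q : A, (2 : ℤ) • Q = z) ↔ ∃ Q : A, (∀ q ∈ L, ρ (τ q) Q = Q) ∧ (2 : ℤ) • Q = z := by
  refine ⟨fun h2 ↦ ?_, fun ⟨Q, _, hQ⟩ ↦ ⟨Q, hQ⟩⟩
  induction L with
  | nil =>
    obtain ⟨Q, hQ⟩ := h2
    exact ⟨Q, fun q hq ↦ by simp at hq, hQ⟩
  | cons q L ih =>
    obtain ⟨Q, hQL, hQ⟩ := ih (fun a ha b hb ↦ hcomm a (List.mem_cons_of_mem q ha) b (List.mem_cons_of_mem q hb))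
      (fun a ha ↦ hodd a (List.mem_cons_of_mem q ha)) (fun a ha ↦ hτ a (List.mem_cons_of_mem q ha))
      (fun a ha ↦ hz a (List.mem_cons_of_mem q ha))
    have hq : q ∈ q :: L := List.mem_cons_self
    obtain ⟨r, hr⟩ := hodd q hq
    -- the `⟨τ_q⟩`-average of `Q`, corrected by a multiple of `z`
    set N : A := ∑ k ∈ range (m q), ρ (τ q ^ k) Q with hN
    have hNfix : ρ (τ q) N = N := map_sum_range_pow_eq_self ρ (τ q) (m q) (hτ q hq) Q
    have h2N : (2 : ℤ) • N = (m q : ℤ) • z := by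
      rw [hN, Finset.smul_sum]
      simp only [← map_zsmul, hQ, map_pow_eq_self_of_map_eq_self ρ (τ q) z (hz q hq)]
      rw [Finset.sum_const, Finset.card_range, natCast_zsmul]
    -- the other `τ_{q'}` still fix the average
    have hNL : ∀ q' ∈ L, ρ (τ q') N = N := fun q' hq' ↦ by
      rw [hN, map_sum]
      refine Finset.sum_congr rfl fun k _ ↦ ?_
      have hc := ((hcomm q' (List.mem_cons_of_mem q hq') q hq).pow_right k).eq
      have h' := congrArg (fun g ↦ ρ g Q) hc
      simp only [map_mul] at h'
      -- `h' : ρ (τ q') (ρ (τ q ^ k) Q) = ρ (τ q ^ k) (ρ (τ q') Q)`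
      refine h'.trans ?_
      change ρ (τ q ^ k) (ρ (τ q') Q) = _
      rw [hQL q' hq']
    refine ⟨N - (r : ℤ) • z, fun a ha ↦ ?_, ?_⟩
    · rcases List.mem_cons.mp ha with rfl | haL
      · rw [map_sub, map_zsmul, hNfix, hz a hq]
      · rw [map_sub, map_zsmul, hNL a haL, hz a (List.mem_cons_of_mem _ haL)]
    · rw [smul_sub, h2N, smul_smul, ← sub_smul]
      have h1 : (m q : ℤ) - 2 * r = 1 := by omega
      rw [h1, one_smul]

/-- **`τ_ℓ 𝒩_L y = 𝒩_L y` for the square-generators**: with `τ_q = σ_q²`, for `ℓ ∈ L`, pairwise commuting `σ`'s and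
`(σ_ℓ²)^{(ℓ+1)/2} = 1`, the operator `σ_ℓ²` fixes the norm part `𝒩_L y = ∏_{q∈L} Σ_{k<(q+1)/2} σ_q^{2k} y` (it rotates the
`ℓ`-factor and commutes past the others). [folklore] -/
theorem map_σ_sq_foldr_normPart_eq_self (σ : ℕ → G) (ℓ : ℕ) (hℓ : (σ ℓ ^ 2) ^ ((ℓ + 1) / 2) = 1) (L : List ℕ) (hℓL : ℓ ∈ L)
    (hcomm : ∀ q ∈ L, Commute (σ ℓ) (σ q)) (y : A) :
    ρ (σ ℓ ^ 2) (L.foldr (fun q x ↦ ∑ k ∈ range ((q + 1) / 2), ρ ((σ q ^ 2) ^ k) x) y) =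
      L.foldr (fun q x ↦ ∑ k ∈ range ((q + 1) / 2), ρ ((σ q ^ 2) ^ k) x) y := by
  induction L with
  | nil => simp at hℓL
  | cons q L ih =>
    have hcommL : ∀ q' ∈ L, Commute (σ ℓ) (σ q') := fun q' h ↦ hcomm q' (List.mem_cons_of_mem q h)
    simp only [List.foldr_cons]
    set z := L.foldr (fun q x ↦ ∑ k ∈ range ((q + 1) / 2), ρ ((σ q ^ 2) ^ k) x) y with hz
    by_cases hq : q = ℓ
    · subst hq
      exact map_sum_range_pow_eq_self ρ (σ q ^ 2) ((q + 1) / 2) hℓ z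
    · have hℓL' : ℓ ∈ L := by
        rcases List.mem_cons.mp hℓL with h | h
        · exact absurd h.symm hq
        · exact h
      have hc : ∀ k : ℕ, ρ (σ ℓ ^ 2) (ρ ((σ q ^ 2) ^ k) z) = ρ ((σ q ^ 2) ^ k) (ρ (σ ℓ ^ 2) z) := fun k ↦ by
        have h := ((((hcomm q List.mem_cons_self).pow_left 2).pow_right 2).pow_right k).eq
        have h' := congrArg (fun g ↦ ρ g z) h
        simp only [map_mul] at h'
        exact h'
      rw [map_sum]
      refine Finset.sum_congr rfl fun k _ ↦ ?_
      rw [hc k, ih hℓL' hcommL]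

end Algebra

/-! ## §2 Heegner data at an all-shallow CM-inert Kolyvagin level -/

section Heegner

open WeierstrassCurve NumberField Literature.NumberTheory.EllipticCurves
  Literature.NumberTheory.EllipticCurves.ModularForms Literature.NumberTheory.EllipticCurves.Rank1Residual
  Summit.BirchSwinnertonDyer.BirchSwinnertonDyer.Theorems

variable {K : Type} [Field K] [NumberField K]

/-- `(σ_ℓ²)^{(ℓ+1)/2} = 1` at a prime factor `ℓ` (odd, inert in `K`) of the square-free conductor `n` of a datum
(`orderOf σ_ℓ = ℓ + 1`, p799182 `orderOf_σ_eq_succ_of_mem_primeFactors`). [cite: GrossLMS1991, §3 (G_ℓ cyclic of order ℓ+1)] -/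
theorem σ_sq_pow_half_eq_one_of_mem_primeFactors (W : WeierstrassCurve ℚ) {N : ℕ} [NeZero N]
    (hK : IsImaginaryQuadratic K) (hodd : Odd (NumberField.discr K)) (h3 : NumberField.discr K ≠ -3)
    {Dt : ModularParametrizationData W N} {β : ℤ} {ι : K →+* ℂ} {n : ℕ} (hn : Squarefree n)
    (d : KolyvaginHeegnerData Dt β ι n) {ℓ : ℕ} (hℓn : ℓ ∈ n.primeFactors) (hℓodd : Odd ℓ)
    (hinert : (Ideal.span {(ℓ : 𝓞 K)}).IsPrime) :
    (d.σ ℓ ^ 2) ^ ((ℓ + 1) / 2) = 1 := by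
  have h2 : 2 * ((ℓ + 1) / 2) = ℓ + 1 := by obtain ⟨r, hr⟩ := hℓodd; omega
  rw [← pow_mul, h2, ← orderOf_σ_eq_succ_of_mem_primeFactors W hK hodd h3 hn d hℓn hinert]
  exact pow_orderOf_eq_one _

/-- **Every `σ_ℓ²` (`ℓ ∣ n`) fixes the genus trace** `G = Σ_{s∈S} s(𝒩_n y(n))` at a square-free level `n` whose prime factors
are Zhang–Kolyvagin primes at `2` (odd, inert in `K`; `K` with odd `d_K ≠ −3`): `𝒢_n` is abelian and `σ_ℓ²` fixes `𝒩_n y(n)`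
(`map_σ_sq_foldr_normPart_eq_self`). [cite: GrossLMS1991, §3 (𝒢_n abelian, (3.5)), §4 (4.1)] -/
theorem pointGalHom_σ_sq_genusTrace (W : WeierstrassCurve ℚ) [W.IsElliptic] [W.IsGloballyMinimal]
    [NeZero (W.conductorNorm ℤ)] (hK : IsImaginaryQuadratic K)
    (hodd : Odd (NumberField.discr K)) (h3 : NumberField.discr K ≠ -3)
    {Dt : ModularParametrizationData W (W.conductorNorm ℤ)} {β : ℤ} {ι : K →+* ℂ} {n : ℕ} (hn : Squarefree n)
    (hKol : ∀ ℓ ∈ n.primeFactors, Zhang2014.IsKolyvaginPrime (W.conductorNorm ℤ) W K 2 ℓ)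
    (d : KolyvaginHeegnerData Dt β ι n) {ℓ : ℕ} (hℓn : ℓ ∈ n.primeFactors) :
    pointGalHom W (ringClassField K ι n) (d.σ ℓ ^ 2)
        (∑ s ∈ d.S, pointGalHom W (ringClassField K ι n) s
          (n.primeFactorsList.foldr
            (fun q x ↦ ∑ k ∈ range ((q + 1) / 2), pointGalHom W (ringClassField K ι n) ((d.σ q ^ 2) ^ k) x) d.y)) =
      ∑ s ∈ d.S, pointGalHom W (ringClassField K ι n) s
        (n.primeFactorsList.foldr
          (fun q x ↦ ∑ k ∈ range ((q + 1) / 2), pointGalHom W (ringClassField K ι n) ((d.σ q ^ 2) ^ k) x) d.y) := by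
  have hn0 : n ≠ 0 := hn.ne_zero
  have hmem : ∀ q ∈ n.primeFactorsList, q ∈ n.primeFactors := fun q hq ↦
    Nat.mem_primeFactors_iff_mem_primeFactorsList.mpr hq
  have hℓL : ℓ ∈ n.primeFactorsList := Nat.mem_primeFactors_iff_mem_primeFactorsList.mp hℓn
  have hσG : d.σ ℓ ∈ ringClassGal ι n :=
    ringClassGalOver_le_ringClassGal ι n (n / ℓ) (by rw [← d.zpowers_σ ℓ hℓn]; exact Subgroup.mem_zpowers _)
  have hσ2G : d.σ ℓ ^ 2 ∈ ringClassGal ι n := Subgroup.pow_mem _ hσG 2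
  have hfix := map_σ_sq_foldr_normPart_eq_self (pointGalHom W (ringClassField K ι n)) d.σ ℓ
    (σ_sq_pow_half_eq_one_of_mem_primeFactors W hK hodd h3 hn d hℓn
      ((hKol ℓ hℓn).1.odd_of_ne_two (hKol ℓ hℓn).2.2.2.1) (hKol ℓ hℓn).2.2.2.2.1)
    n.primeFactorsList hℓL (fun q hq ↦ commute_σ_of_mem_primeFactors W hK hn0 d hℓn (hmem q hq)) d.y
  rw [map_sum]
  refine Finset.sum_congr rfl fun s hs ↦ ?_
  have hc : d.σ ℓ ^ 2 * s = s * d.σ ℓ ^ 2 := commute_of_mem_ringClassGal hK hn0 hσ2G (d.S_subset s hs)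
  have h' := congrArg (fun g ↦ pointGalHom W (ringClassField K ι n) g
    (n.primeFactorsList.foldr
      (fun q x ↦ ∑ k ∈ range ((q + 1) / 2), pointGalHom W (ringClassField K ι n) ((d.σ q ^ 2) ^ k) x) d.y)) hc
  simp only [map_mul] at h'
  refine h'.trans ?_
  change pointGalHom W (ringClassField K ι n) s (pointGalHom W (ringClassField K ι n) (d.σ ℓ ^ 2)
    (n.primeFactorsList.foldr
      (fun q x ↦ ∑ k ∈ range ((q + 1) / 2), pointGalHom W (ringClassField K ι n) ((d.σ q ^ 2) ^ k) x) d.y)) = _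
  rw [hfix]

/-- **Every `σ_ℓ` (`ℓ ∣ n`) negates the genus trace** on a frame of the stub (`W/ℚ` globally minimal with CM, `K` with odd
`d_K ≠ −3` and Heegner for `N_E`, `n` square-free with CM-inert Zhang–Kolyvagin prime factors): `σ_ℓ G = −G`
(p799182 `map_σ_foldr_normPart_eq_neg`: `σ_ℓ 𝒩_n y(n) = −𝒩_n y(n)`; `𝒢_n` abelian). [cite: GrossLMS1991, §3 Prop. 3.7 (1), §4 (4.1)] -/
theorem pointGalHom_σ_genusTrace_eq_neg (W : WeierstrassCurve ℚ) [W.IsElliptic] [W.IsGloballyMinimal]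
    [NeZero (W.conductorNorm ℤ)] (hCM : W.HasCM) (hK : IsImaginaryQuadratic K)
    (hodd : Odd (NumberField.discr K)) (h3 : NumberField.discr K ≠ -3)
    (hH : SatisfiesHeegnerHypothesis (W.conductorNorm ℤ) K)
    {Dt : ModularParametrizationData W (W.conductorNorm ℤ)} {β : ℤ} {ι : K →+* ℂ} {n : ℕ} (hn : Squarefree n)
    (hKol : ∀ ℓ ∈ n.primeFactors, Zhang2014.IsKolyvaginPrime (W.conductorNorm ℤ) W K 2 ℓ ∧ CMInert W ℓ)
    (d : KolyvaginHeegnerData Dt β ι n) {ℓ : ℕ} (hℓn : ℓ ∈ n.primeFactors) :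
    pointGalHom W (ringClassField K ι n) (d.σ ℓ)
        (∑ s ∈ d.S, pointGalHom W (ringClassField K ι n) s
          (n.primeFactorsList.foldr
            (fun q x ↦ ∑ k ∈ range ((q + 1) / 2), pointGalHom W (ringClassField K ι n) ((d.σ q ^ 2) ^ k) x) d.y)) =
      -∑ s ∈ d.S, pointGalHom W (ringClassField K ι n) s
        (n.primeFactorsList.foldr
          (fun q x ↦ ∑ k ∈ range ((q + 1) / 2), pointGalHom W (ringClassField K ι n) ((d.σ q ^ 2) ^ k) x) d.y) := by
  have hn0 : n ≠ 0 := hn.ne_zero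
  have hmem : ∀ q ∈ n.primeFactorsList, q ∈ n.primeFactors := fun q hq ↦
    Nat.mem_primeFactors_iff_mem_primeFactorsList.mpr hq
  have hℓL : ℓ ∈ n.primeFactorsList := Nat.mem_primeFactors_iff_mem_primeFactorsList.mp hℓn
  have hσG : d.σ ℓ ∈ ringClassGal ι n :=
    ringClassGalOver_le_ringClassGal ι n (n / ℓ) (by rw [← d.zpowers_σ ℓ hℓn]; exact Subgroup.mem_zpowers _)
  have hneg := map_σ_foldr_normPart_eq_neg (pointGalHom W (ringClassField K ι n)) d.σ ℓ
    ((hKol ℓ hℓn).1.1.odd_of_ne_two (hKol ℓ hℓn).1.2.2.2.1) n.primeFactorsList hℓL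
    (fun q hq ↦ commute_σ_of_mem_primeFactors W hK hn0 d hℓn (hmem q hq)) d.y
    (sum_range_pointGalHom_σ_pow_y_eq_zero_of_mem_primeFactors W hCM hK hodd h3 hH hn hKol d hℓn)
  rw [map_sum, ← Finset.sum_neg_distrib]
  refine Finset.sum_congr rfl fun s hs ↦ ?_
  have hc : d.σ ℓ * s = s * d.σ ℓ := commute_of_mem_ringClassGal hK hn0 hσG (d.S_subset s hs)
  have h' := congrArg (fun g ↦ pointGalHom W (ringClassField K ι n) g
    (n.primeFactorsList.foldr
      (fun q x ↦ ∑ k ∈ range ((q + 1) / 2), pointGalHom W (ringClassField K ι n) ((d.σ q ^ 2) ^ k) x) d.y)) hc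
  simp only [map_mul] at h'
  refine h'.trans ?_
  change pointGalHom W (ringClassField K ι n) s (pointGalHom W (ringClassField K ι n) (d.σ ℓ)
    (n.primeFactorsList.foldr
      (fun q x ↦ ∑ k ∈ range ((q + 1) / 2), pointGalHom W (ringClassField K ι n) ((d.σ q ^ 2) ^ k) x) d.y)) = _
  rw [hneg, map_neg]

/-- **ALL-SHALLOW GENUS DESCENT.** Frame: `W/ℚ` globally minimal with CM, `K` imaginary quadratic with odd `d_K ≠ −3` and
Heegner for `N_E`; `n` square-free, every prime factor `ℓ` a Zhang–Kolyvagin prime at `2` inert in `F` with `ℓ ≡ 1 (mod 4)`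
(`M(ℓ) = 1`); any datum `d` of conductor `n`. With `G = Σ_{s∈S} s(𝒩_n y(n))` the genus trace:
**`P(n) ∈ 2E(K[n]) ⟺ ∃ Q, (∀ ℓ ∣ n, σ_ℓ² Q = Q) ∧ 2Q = G`** — the half may be taken in `E(K[n])^{H_n}` (= `E(L_n)`, `L_n` the
genus `2`-layer), because `|H_n| = ∏ (ℓ+1)/2` is ODD (p795141 `two_dvd_derivedPoint_iff_two_dvd_genusTrace` +
`two_dvd_iff_exists_forall_fixed_of_odd`). [cite: GrossLMS1991, §3 (3.5), §4 (4.1)] [cite: WZhang2014, Notations (xii), §3.7] -/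
theorem two_dvd_derivedPoint_iff_exists_forall_fixed_of_allShallow (W : WeierstrassCurve ℚ) [W.IsElliptic]
    [W.IsGloballyMinimal] [NeZero (W.conductorNorm ℤ)] (hCM : W.HasCM) (hK : IsImaginaryQuadratic K)
    (hodd : Odd (NumberField.discr K)) (h3 : NumberField.discr K ≠ -3)
    (hH : SatisfiesHeegnerHypothesis (W.conductorNorm ℤ) K)
    {Dt : ModularParametrizationData W (W.conductorNorm ℤ)} {β : ℤ} {ι : K →+* ℂ} {n : ℕ} (hn : Squarefree n)
    (hKol : ∀ ℓ ∈ n.primeFactors, Zhang2014.IsKolyvaginPrime (W.conductorNorm ℤ) W K 2 ℓ ∧ CMInert W ℓ)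
    (hsh : ∀ ℓ ∈ n.primeFactors, ℓ % 4 = 1) (d : KolyvaginHeegnerData Dt β ι n) :
    (∃ Q : (W.baseChange (ringClassField K ι n)).toAffine.Point, (2 : ℤ) • Q = d.derivedPoint) ↔
      ∃ Q : (W.baseChange (ringClassField K ι n)).toAffine.Point,
        (∀ ℓ ∈ n.primeFactors, pointGalHom W (ringClassField K ι n) (d.σ ℓ ^ 2) Q = Q) ∧ (2 : ℤ) • Q =
          ∑ s ∈ d.S, pointGalHom W (ringClassField K ι n) s
            (n.primeFactorsList.foldr
              (fun q x ↦ ∑ k ∈ range ((q + 1) / 2), pointGalHom W (ringClassField K ι n) ((d.σ q ^ 2) ^ k) x) d.y) := by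
  have hn0 : n ≠ 0 := hn.ne_zero
  have hmem : ∀ q ∈ n.primeFactorsList, q ∈ n.primeFactors := fun q hq ↦
    Nat.mem_primeFactors_iff_mem_primeFactorsList.mpr hq
  rw [two_dvd_derivedPoint_iff_two_dvd_genusTrace W hCM hK hodd h3 hH hn hKol d]
  have key := two_dvd_iff_exists_forall_fixed_of_odd (pointGalHom W (ringClassField K ι n)) (fun q ↦ d.σ q ^ 2)
    (fun q ↦ (q + 1) / 2) n.primeFactorsList
    (fun q hq q' hq' ↦ ((commute_σ_of_mem_primeFactors W hK hn0 d (hmem q hq) (hmem q' hq')).pow_left 2).pow_right 2)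
    (fun q hq ↦ by
      have h := hsh q (hmem q hq)
      rw [Nat.odd_iff]
      omega)
    (fun q hq ↦ σ_sq_pow_half_eq_one_of_mem_primeFactors W hK hodd h3 hn d (hmem q hq)
      ((hKol q (hmem q hq)).1.1.odd_of_ne_two (hKol q (hmem q hq)).1.2.2.2.1) (hKol q (hmem q hq)).1.2.2.2.2.1)
    _ (fun q hq ↦ pointGalHom_σ_sq_genusTrace W hK hodd h3 hn (fun ℓ hℓ ↦ (hKol ℓ hℓ).1) d (hmem q hq))
  rw [key]
  constructor
  · rintro ⟨Q, hfix, hQ⟩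
    exact ⟨Q, fun ℓ hℓ ↦ hfix ℓ (Nat.mem_primeFactors_iff_mem_primeFactorsList.mp hℓ), hQ⟩
  · rintro ⟨Q, hfix, hQ⟩
    exact ⟨Q, fun ℓ hℓ ↦ hfix ℓ (hmem ℓ hℓ), hQ⟩

/-- `E(K[n])[2] = 0` on H₂ at every square-free CM-inert level (`W` with CM, `2` inert in `F`, `ρ̄_{E,2}` onto, Heegner for
`N_E`): the CM prime `q = |d_F|` divides `N_E` and does not divide `n` (the prime factors of `n` are inert in `F`, `q` is
ramified), so tree `twoTorsion_eq_zero_ringClassField_of_cmInert_two_of_heegner` applies. [cite: GrossLMS1991, §4 Lemma 4.3] -/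
theorem twoTorsion_eq_zero_of_cmInert_squarefree (W : WeierstrassCurve ℚ) [W.IsElliptic] [W.IsGloballyMinimal]
    (hCM : W.HasCM) (hin : CMInert W 2) (hρ : W.HasSurjectiveModNGaloisRep (2 : ℤ))
    (hK : IsImaginaryQuadratic K) (ι : K →+* ℂ) (hH : SatisfiesHeegnerHypothesis (W.conductorNorm ℤ) K)
    {n : ℕ} (hn : Squarefree n) (hF : ∀ ℓ ∈ n.primeFactors, CMInert W ℓ)
    (P : (W.baseChange (ringClassField K ι n)).toAffine.Point) (hP : (2 : ℤ) • P = 0) : P = 0 := by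
  obtain ⟨q, hq, hq2, hdF⟩ := KolyvaginFrobeniusTwo.exists_prime_cmFieldDiscr_eq_neg_of_cmInert_two W hin
  have hqN : (cmFieldDiscrOfJ W.j).natAbs ∣ W.conductorNorm ℤ := by
    rw [hdF, Int.natAbs_neg, Int.natAbs_natCast]
    exact KolyvaginFrobeniusTwo.cmPrime_dvd_conductorNorm_of_cmInert_two W hCM hq hq2 hdF
  have hqn : ¬ (cmFieldDiscrOfJ W.j).natAbs ∣ n := by
    rw [hdF, Int.natAbs_neg, Int.natAbs_natCast]
    intro hdvd
    have hqmem : q ∈ n.primeFactors := Nat.mem_primeFactors.mpr ⟨hq, hdvd, hn.ne_zero⟩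
    exact (hF q hqmem).1 (by rw [CMRamified, hdF]; exact dvd_neg.mpr dvd_rfl)
  refine twoTorsion_eq_zero_ringClassField_of_cmInert_two_of_heegner W hρ hin hK ι hH hqN hn.ne_zero hqn P ?_
  rw [← natCast_zsmul]
  exact_mod_cast hP

/-- **ALL-SHALLOW GENUS DESCENT ON H₂, anti-invariant form.** Same frame with moreover `2` inert in `F` and `ρ̄_{E,2}` onto
(so `E(K[n])[2] = 0`): at a square-free level `n` all of whose prime factors are CM-inert Zhang–Kolyvagin primes at `2` with
`ℓ ≡ 1 (mod 4)`, for any datum `d`: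
**`P(n) ∈ 2E(K[n]) ⟺ ∃ Q, (∀ ℓ ∣ n, σ_ℓ² Q = Q ∧ σ_ℓ Q = −Q) ∧ 2Q = G`** — the half of the genus trace is fixed by `H_n` and
NEGATED by every `σ_ℓ`: a point of the `χ_n`-part of `E(L_n)` for the genus character `χ_n` with `χ_n(σ_ℓ) = −1` (`ℓ ∣ n`), i.e.
a `K[1]`-point of ONE quadratic twist of `E` (by `χ_n`; `K[1](√n)` when all `ℓ ≡ 1 (mod 4)`). (`σ_ℓ Q + Q` is `2`-torsion since
`σ_ℓ G = −G`.) [cite: GrossLMS1991, §3 (3.5), Prop. 3.7 (1), §4 (4.1), Lemma 4.3] [cite: WZhang2014, §3.7] [cite: Cox2013, §9.A] -/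
theorem two_dvd_derivedPoint_iff_exists_forall_anti_of_allShallow (W : WeierstrassCurve ℚ) [W.IsElliptic]
    [W.IsGloballyMinimal] [NeZero (W.conductorNorm ℤ)] (hCM : W.HasCM) (hin : CMInert W 2)
    (hρ : W.HasSurjectiveModNGaloisRep (2 : ℤ)) (hK : IsImaginaryQuadratic K)
    (hodd : Odd (NumberField.discr K)) (h3 : NumberField.discr K ≠ -3)
    (hH : SatisfiesHeegnerHypothesis (W.conductorNorm ℤ) K)
    {Dt : ModularParametrizationData W (W.conductorNorm ℤ)} {β : ℤ} {ι : K →+* ℂ} {n : ℕ} (hn : Squarefree n)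
    (hKol : ∀ ℓ ∈ n.primeFactors, Zhang2014.IsKolyvaginPrime (W.conductorNorm ℤ) W K 2 ℓ ∧ CMInert W ℓ)
    (hsh : ∀ ℓ ∈ n.primeFactors, ℓ % 4 = 1) (d : KolyvaginHeegnerData Dt β ι n) :
    (∃ Q : (W.baseChange (ringClassField K ι n)).toAffine.Point, (2 : ℤ) • Q = d.derivedPoint) ↔
      ∃ Q : (W.baseChange (ringClassField K ι n)).toAffine.Point,
        (∀ ℓ ∈ n.primeFactors, pointGalHom W (ringClassField K ι n) (d.σ ℓ ^ 2) Q = Q ∧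
          pointGalHom W (ringClassField K ι n) (d.σ ℓ) Q = -Q) ∧ (2 : ℤ) • Q =
          ∑ s ∈ d.S, pointGalHom W (ringClassField K ι n) s
            (n.primeFactorsList.foldr
              (fun q x ↦ ∑ k ∈ range ((q + 1) / 2), pointGalHom W (ringClassField K ι n) ((d.σ q ^ 2) ^ k) x) d.y) := by
  rw [two_dvd_derivedPoint_iff_exists_forall_fixed_of_allShallow W hCM hK hodd h3 hH hn hKol hsh d]
  refine ⟨fun ⟨Q, hfix, hQ⟩ ↦ ⟨Q, fun ℓ hℓ ↦ ⟨hfix ℓ hℓ, ?_⟩, hQ⟩, fun ⟨Q, hfix, hQ⟩ ↦ ⟨Q, fun ℓ hℓ ↦ (hfix ℓ hℓ).1, hQ⟩⟩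
  have hg := pointGalHom_σ_genusTrace_eq_neg W hCM hK hodd h3 hH hn hKol d hℓ
  have h2 : (2 : ℤ) • (pointGalHom W (ringClassField K ι n) (d.σ ℓ) Q + Q) = 0 := by
    rw [smul_add, ← map_zsmul, hQ, hg, neg_add_cancel]
  have h0 := twoTorsion_eq_zero_of_cmInert_squarefree W hCM hin hρ hK ι hH hn (fun q hq ↦ (hKol q hq).2) _ h2
  exact eq_neg_of_add_eq_zero_left h0

end Heegner

end Summit.BirchSwinnertonDyer.BirchSwinnertonDyer.Theorems.CMKolyvaginConjecturePositiveDepth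

end
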